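import Mathlib
import HarnessLib
import Summits.HubbardSuperconductivity.HubbardSuperconductivity.Theorems.KLProgrammeForwardBubbleRayTube
import Summits.HubbardSuperconductivity.HubbardSuperconductivity.Theorems.KLProgrammeMatsubaraSliceBubbleWindowQuasi

/-!
# Route `KLProgramme` — ENGINE stmt-HubbardSuperconductivity-20437 `KLRegimeEngineV17F2`, row (c) value lane: the forward slice bubble with TUBE-LOCAL QUASI-LIPSCHITZ vertex data
# (brick 3′-5 of cure (A″) of located «(c)-OUT-COOPER-ANTIPODE», route 3′; cell gate-hubbard-kl, seat hubbard-kl-k3c2-p2 g25; sequel of `…ForwardBubbleRayTube` p720374)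

WHY.  Route 3′ (CELL-SIGNATURES.md §G, evidence on 20437): the planar vertex weight is the landed GLOBAL McShane extension of the lattice pins; a CELL of lattice data gives on
each ray's tube segment only a QUASI-Lipschitz radial datum `‖A(t·dir θ) − A(t'·dir θ)‖ ≤ A₁(θ)|t − t'| + δ_A(θ)`, `δ_A ∝ (K_g + L_c)/L`.  This file threads the defect
through the per-ray and planar forward-bubble lemmas (calling `klsw_slice_bubble_transfer_norm_le_quasi`, brick 3′-4): the bound gains the SCALE-FREE term
`(131072/π)(ℓ + 8M_F)·(π√2/(Dt_min − κ₁))·δ_A(θ)`, integrated over θ in the planar form — booked in the lattice slot `¼Q.CL β n/L` on route 3′.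
* `klfb_weight_sub_zero_norm_le_tube_quasi`; **`klfb_ray_bubble_norm_le_tube_quasi`**; **`klfb_planar_bubble_norm_le_fn_tube_quasi`**.
`δ_A = 0` recovers …ForwardBubbleRayTube.  Pure analysis; nothing about the model is asserted.  0 kit · 0 lit.
-/

noncomputable section

namespace Summit.HubbardSuperconductivity.HubbardSuperconductivity.Theorems.KLRegimeSplit

set_option linter.dupNamespace false -- summit = problem name (single-conjunct summit), D-0017

open Real Set Filter MeasureTheory intervalIntegral Complex Literature.MathematicalPhysics.QuantumLattice
open Literature.MathematicalPhysics.QuantumLattice.BandSectorCounting Literature.Probability.LatticeModels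
open Summit.HubbardSuperconductivity.HubbardSuperconductivity.Theorems.PerturbedFermiCurve
open Summit.HubbardSuperconductivity.HubbardSuperconductivity.Theorems.KLProgrammeLegKernels
open Summit.HubbardSuperconductivity.HubbardSuperconductivity.Theorems.DispersionFlow

section Frame

variable {a b : ℝ} (B : BandBounds a b) {δ : (Fin 2 → ℝ) → ℝ} (hδ1 : ContDiff ℝ 1 δ) {κ₀ κ₁ : ℝ}
  (hδ : ∀ k : Fin 2 → ℝ, (∀ i, |k i| ≤ π) → |δ k| ≤ κ₀)
  (hκ : ∀ k : Fin 2 → ℝ, (∀ i, |k i| ≤ π) → ‖fderiv ℝ δ k‖ ≤ κ₁) (hκ₁ : κ₁ < B.Dtmin)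

/-! ## §1 Quasi-Lipschitz tube-local data -/

include B hδ1 hδ hκ hκ₁ in
/-- **QUASI-Lipschitz of the insertion at `e = 0` from QUASI-Lipschitz data on the TUBE SEGMENT of the ray** (`|e| < 4Λₙ`): sup `A₀` and radial quasi-Lipschitz
`‖A(t·dir θ) − A(t'·dir θ)‖ ≤ A₁|t − t'| + δ_A` asked only for `t, t' ≥ 0` in the tube; conclusion `‖W_θ(e) − W_θ(0)‖ ≤ L_W·|e| + (π√2/d)·δ_A`. -/
theorem klfb_weight_sub_zero_norm_le_tube_quasi {A : ℝ × ℝ → ℂ} {A₀ A₁ δA : ℝ} (hA1' : 0 ≤ A₁) {θ : ℝ} {n : ℕ} {μ : ℝ}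
    (hA0 : ∀ t : ℝ, 0 ≤ t → |klfb_band δ μ (t * Real.cos θ, t * Real.sin θ)| < 4 * klScale klE0 n → ‖A (t * Real.cos θ, t * Real.sin θ)‖ ≤ A₀)
    (hA1 : ∀ t t' : ℝ, 0 ≤ t → 0 ≤ t' → |klfb_band δ μ (t * Real.cos θ, t * Real.sin θ)| < 4 * klScale klE0 n →
      |klfb_band δ μ (t' * Real.cos θ, t' * Real.sin θ)| < 4 * klScale klE0 n →
      ‖A (t * Real.cos θ, t * Real.sin θ) - A (t' * Real.cos θ, t' * Real.sin θ)‖ ≤ A₁ * |t - t'| + δA)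
    {κ₂ : ℝ} (hκ₂ : 0 ≤ κ₂)
    (hD2 : ∀ s t : ℝ, s ∈ Icc 0 (π / ‖dir θ‖) → t ∈ Icc 0 (π / ‖dir θ‖) →
      |fderiv ℝ δ (s • dir θ) (dir θ) - fderiv ℝ δ (t • dir θ) (dir θ)| ≤ κ₂ * |s - t|)
    {e : ℝ} (he : |e| < 4 * klScale klE0 n) (hμlo : a ≤ μ - κ₀) (hμhi : μ + κ₀ ≤ b) (hlo : a ≤ μ + e - κ₀) (hhi : μ + e + κ₀ ≤ b) :
    ‖klfb_weight δ μ A θ e - klfb_weight δ μ A θ 0‖ ≤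
      (Real.pi * Real.sqrt 2 / (B.Dtmin - κ₁) * A₁ / (B.Dtmin - κ₁) +
          A₀ * (1 / (B.Dtmin - κ₁) ^ 2 + Real.pi * Real.sqrt 2 * (2 + κ₂) / (B.Dtmin - κ₁) ^ 3)) * |e| +
        Real.pi * Real.sqrt 2 / (B.Dtmin - κ₁) * δA := by
  have hδc : Continuous δ := hδ1.continuous
  have hΛ := klth_klScale_pos n
  set d := B.Dtmin - κ₁ with hd_def
  have hd : 0 < d := by rw [hd_def]; linarith
  have hμ0lo : a ≤ μ + 0 - κ₀ := by simpa using hμlo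
  have hμ0hi : μ + 0 + κ₀ ≤ b := by simpa using hμhi
  set J := klfb_jac δ μ θ e with hJ_def
  set J0 := klfb_jac δ μ θ 0 with hJ0_def
  set u := perturbedFermiRadius δ (μ + e) θ with hu_def
  set u0 := perturbedFermiRadius δ (μ + 0) θ with hu0_def
  have hJnn : 0 ≤ J := klrj_jacobian_nonneg B hδ hκ hκ₁ hδc hlo hhi θ
  have hJle : J ≤ Real.pi * Real.sqrt 2 / d := klrj_jacobian_le B hδ hκ hκ₁ hδc hlo hhi θ
  have hJlip : |J - J0| ≤ (1 / d ^ 2 + Real.pi * Real.sqrt 2 * (2 + κ₂) / d ^ 3) * |(μ + e) - (μ + 0)| :=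
    klrj_jacobian_lipschitz B hδ1 hδ hκ hκ₁ hκ₂ hD2 hlo hhi hμ0lo hμ0hi
  have heq : |(μ + e) - (μ + 0)| = |e| := by ring_nf
  rw [heq] at hJlip
  have hu0nn : 0 ≤ u0 := (perturbedFermiRadius_mem_Ioo B hδc hδ hμ0lo hμ0hi θ).1.le
  have hunn : 0 ≤ u := (perturbedFermiRadius_mem_Ioo B hδc hδ hlo hhi θ).1.le
  have hulip : |u - u0| ≤ |(μ + e) - (μ + 0)| / d := klrf_level_lipschitz B hδ1 hδ hκ hκ₁ hμ0lo hμ0hi hlo hhi θ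
  rw [heq] at hulip
  have hband : |klfb_band δ μ (klfb_rayPt δ μ θ e)| < 4 * klScale klE0 n := by rw [klfb_band_rayPt B hδ hδc hlo hhi θ]; exact he
  have hband0 : |klfb_band δ μ (klfb_rayPt δ μ θ 0)| < 4 * klScale klE0 n := by
    rw [klfb_band_rayPt B hδ hδc hμ0lo hμ0hi θ, abs_zero]; positivity
  have hAdiff : ‖A (klfb_rayPt δ μ θ e) - A (klfb_rayPt δ μ θ 0)‖ ≤ A₁ * |u - u0| + δA := by
    unfold klfb_rayPt at hband hband0 ⊢
    exact hA1 u u0 hunn hu0nn hband hband0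
  have hsplit : klfb_weight δ μ A θ e - klfb_weight δ μ A θ 0 =
      (J : ℂ) * (A (klfb_rayPt δ μ θ e) - A (klfb_rayPt δ μ θ 0)) + ((J : ℂ) - (J0 : ℂ)) * A (klfb_rayPt δ μ θ 0) := by
    unfold klfb_weight; ring
  rw [hsplit]
  have hA00 : ‖A (klfb_rayPt δ μ θ 0)‖ ≤ A₀ := by
    unfold klfb_rayPt at hband0 ⊢
    exact hA0 u0 hu0nn hband0
  have h1 : ‖(J : ℂ) * (A (klfb_rayPt δ μ θ e) - A (klfb_rayPt δ μ θ 0))‖ ≤ Real.pi * Real.sqrt 2 / d * (A₁ * (|e| / d) + δA) := by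
    rw [norm_mul, Complex.norm_real, Real.norm_of_nonneg hJnn]
    refine mul_le_mul hJle (hAdiff.trans ?_) (norm_nonneg _) (by positivity)
    exact add_le_add (mul_le_mul_of_nonneg_left hulip hA1') le_rfl
  have h2 : ‖((J : ℂ) - (J0 : ℂ)) * A (klfb_rayPt δ μ θ 0)‖ ≤ (1 / d ^ 2 + Real.pi * Real.sqrt 2 * (2 + κ₂) / d ^ 3) * |e| * A₀ := by
    rw [norm_mul, ← Complex.ofReal_sub, Complex.norm_real, Real.norm_eq_abs]
    exact mul_le_mul hJlip hA00 (norm_nonneg _) (by positivity)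
  calc _ ≤ ‖(J : ℂ) * (A (klfb_rayPt δ μ θ e) - A (klfb_rayPt δ μ θ 0))‖ + ‖((J : ℂ) - (J0 : ℂ)) * A (klfb_rayPt δ μ θ 0)‖ :=
        norm_add_le _ _
    _ ≤ Real.pi * Real.sqrt 2 / d * (A₁ * (|e| / d) + δA) + (1 / d ^ 2 + Real.pi * Real.sqrt 2 * (2 + κ₂) / d ^ 3) * |e| * A₀ :=
        add_le_add h1 h2
    _ = _ := by field_simp; ring

include B hδ1 hδ hκ hκ₁ in
/-- **THE FORWARD SLICE BUBBLE ON ONE RAY WITH TUBE-LOCAL QUASI-LIPSCHITZ VERTEX DATA**: `klfb_ray_bubble_norm_le_tube` with the radial datum weakened to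
`‖A(t·dir θ) − A(t'·dir θ)‖ ≤ A₁|t − t'| + δ_A` on the tube segment (what the global McShane extension of CELL lattice data gives, route 3′); the bound gains the
SCALE-FREE defect `(131072/π)(ℓ + 8M_F)·(π√2/(Dt_min − κ₁))·δ_A`. -/
theorem klfb_ray_bubble_norm_le_tube_quasi {A : ℝ × ℝ → ℂ} (hA : Continuous A) (hAsupp : ∀ p : ℝ × ℝ, A p ≠ 0 → |p.1| < π ∧ |p.2| < π)
    (θ : ℝ) {n : ℕ} {μ : ℝ} {A₀ A₁ δA : ℝ} (hA0' : 0 ≤ A₀) (hA1' : 0 ≤ A₁) (hδA : 0 ≤ δA)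
    (hA0 : ∀ t : ℝ, 0 ≤ t → |klfb_band δ μ (t * Real.cos θ, t * Real.sin θ)| < 4 * klScale klE0 n → ‖A (t * Real.cos θ, t * Real.sin θ)‖ ≤ A₀)
    (hA1 : ∀ t t' : ℝ, 0 ≤ t → 0 ≤ t' → |klfb_band δ μ (t * Real.cos θ, t * Real.sin θ)| < 4 * klScale klE0 n →
      |klfb_band δ μ (t' * Real.cos θ, t' * Real.sin θ)| < 4 * klScale klE0 n →
      ‖A (t * Real.cos θ, t * Real.sin θ) - A (t' * Real.cos θ, t' * Real.sin θ)‖ ≤ A₁ * |t - t'| + δA)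
    {κ₂ : ℝ} (hκ₂ : 0 ≤ κ₂)
    (hD2 : ∀ s t : ℝ, s ∈ Icc 0 (π / ‖dir θ‖) → t ∈ Icc 0 (π / ‖dir θ‖) →
      |fderiv ℝ δ (s • dir θ) (dir θ) - fderiv ℝ δ (t • dir θ) (dir θ)| ≤ κ₂ * |s - t|)
    {f f' : ℝ → ℂ} {Lf Mf Lf' Mf' ℓ' LF MF ℓ : ℝ}
    (hlip : ∀ s s', ‖f s - f s'‖ ≤ Lf * |s - s'|) (hbd : ∀ s, ‖f s‖ ≤ Mf)
    (hin : ∀ s, s ≤ (klScale klE0 n / 2) ^ 2 → f s = 0) (hout : ∀ s, (4 * klScale klE0 n) ^ 2 ≤ s → f s = 0)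
    (hlip' : ∀ s s', ‖f' s - f' s'‖ ≤ Lf' * |s - s'|) (hbd' : ∀ s, ‖f' s‖ ≤ Mf') (hLf' : Lf' ≤ ℓ' / klScale klE0 n ^ 2)
    (hin' : ∀ s, s ≤ (klScale klE0 n / 2) ^ 2 → f' s = 0) (hout' : ∀ s, (4 * klScale klE0 n) ^ 2 ≤ s → f' s = 0)
    (hMF : 0 ≤ MF) (hFlip : ∀ s s', ‖f s * f' s - f s' * f' s'‖ ≤ LF * |s - s'|) (hFbd : ∀ s, ‖f s * f' s‖ ≤ MF)
    (hLF : LF ≤ ℓ / klScale klE0 n ^ 2)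
    {e' : ℝ × ℝ → ℝ} (he' : Continuous e') {δmax : ℝ} (hδ0 : 0 ≤ δmax)
    (he'δ : ∀ p : ℝ × ℝ, |p.1| < π → |p.2| < π → |e' p - klfb_band δ μ p| ≤ δmax)
    (hlo : a < μ - 4 * klScale klE0 n - κ₀) (hhi : μ + 4 * klScale klE0 n + κ₀ < b)
    (q₀ : ℝ) {β : ℝ} (hβ : klBetaMin ≤ β) (hn : n ≤ nScales β + 1) {M : ℕ}
    (hM : β * (4 * klScale klE0 n) / (2 * Real.pi) + 1 ≤ M) :
    ‖β⁻¹ • ∑ i : MatsubaraIdx M, ∫ t in Ioi (0 : ℝ),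
        t • klfb_integrand δ μ A f f' e' (matsubaraFreq β M i) q₀ (t * Real.cos θ, t * Real.sin θ)‖ ≤
      524288 / Real.pi * (ℓ + 8 * MF) *
          (Real.pi * Real.sqrt 2 / (B.Dtmin - κ₁) * A₁ / (B.Dtmin - κ₁) +
            A₀ * (1 / (B.Dtmin - κ₁) ^ 2 + Real.pi * Real.sqrt 2 * (2 + κ₂) / (B.Dtmin - κ₁) ^ 3)) * klScale klE0 n +
        131072 / Real.pi * (ℓ + 8 * MF) * (Real.pi * Real.sqrt 2 / (B.Dtmin - κ₁) * δA) +
        393216 / Real.pi * (ℓ + 8 * MF) * (A₀ * (Real.pi * Real.sqrt 2 / (B.Dtmin - κ₁))) * ((Real.pi / β) / klScale klE0 n) +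
          1024 / Real.pi * Mf * (48 * ℓ' + 193 * Mf') * (A₀ * (Real.pi * Real.sqrt 2 / (B.Dtmin - κ₁))) * (|q₀| + δmax) /
            klScale klE0 n := by
  have hδc : Continuous δ := hδ1.continuous
  have hΛ := klth_klScale_pos n
  have hr₁ : 0 < klScale klE0 n / 2 := by positivity
  have hr : 0 < 4 * klScale klE0 n := by positivity
  have hd : 0 < B.Dtmin - κ₁ := by linarith
  have hκ₀ : 0 ≤ κ₀ := (abs_nonneg _).trans (hδ 0 (fun i => by simp [Real.pi_pos.le]))
  have hμlo : a ≤ μ - κ₀ := by linarith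
  have hμhi : μ + κ₀ ≤ b := by linarith
  have hray : ∀ i : MatsubaraIdx M, ∫ t in Ioi (0 : ℝ),
      t • klfb_integrand δ μ A f f' e' (matsubaraFreq β M i) q₀ (t * Real.cos θ, t * Real.sin θ) =
        ∫ e : ℝ, klfb_weight δ μ A θ e * klfb_prop f (matsubaraFreq β M i) e *
          klfb_prop f' (matsubaraFreq β M i + q₀) (e + klfb_shift δ μ e' θ e) := fun i =>
    klfb_ray_bubble_integral_eq B hδ1 hδ hκ hκ₁ hA hAsupp hlip hbd hin hout hr₁ hr hlip' hbd' hin' hout' hr₁ hr he' hlo hhi _ q₀ θ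
  rw [Finset.sum_congr rfl fun i _ => hray i]
  simp only [klfb_prop_apply]
  have hW : ContinuousOn (klfb_weight δ μ A θ) (Icc (-(4 * klScale klE0 n)) (4 * klScale klE0 n)) :=
    klfb_weight_continuousOn B hδ1 hδ hκ hκ₁ hA hlo hhi θ
  have hWlip : ∀ e : ℝ, |e| < 4 * klScale klE0 n → ‖klfb_weight δ μ A θ e - klfb_weight δ μ A θ 0‖ ≤
      (Real.pi * Real.sqrt 2 / (B.Dtmin - κ₁) * A₁ / (B.Dtmin - κ₁) +
          A₀ * (1 / (B.Dtmin - κ₁) ^ 2 + Real.pi * Real.sqrt 2 * (2 + κ₂) / (B.Dtmin - κ₁) ^ 3)) * |e| +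
        Real.pi * Real.sqrt 2 / (B.Dtmin - κ₁) * δA := by
    intro e he
    have he' := abs_lt.mp he
    exact klfb_weight_sub_zero_norm_le_tube_quasi B hδ1 hδ hκ hκ₁ hA1' hA0 hA1 hκ₂ hD2 he hμlo hμhi (by linarith) (by linarith)
  have hWbd : ∀ e : ℝ, |e| < 4 * klScale klE0 n → ‖klfb_weight δ μ A θ e‖ ≤ A₀ * (Real.pi * Real.sqrt 2 / (B.Dtmin - κ₁)) := by
    intro e he
    have he' := abs_lt.mp he
    exact klfb_weight_norm_le_tube B hδ hκ hκ₁ hδc hA0' θ hA0 he (by linarith) (by linarith)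
  have hσc : ContinuousOn (klfb_shift δ μ e' θ) (Icc (-(4 * klScale klE0 n)) (4 * klScale klE0 n)) :=
    klfb_shift_continuousOn B hδ1 hδ hκ hκ₁ he' hlo hhi θ
  have hσ : ∀ e : ℝ, |e| ≤ 4 * klScale klE0 n → |klfb_shift δ μ e' θ e| ≤ δmax := by
    intro e he
    have he' := abs_le.mp he
    exact klfb_shift_abs_le B hδ hδc he'δ (by linarith) (by linarith) θ
  have hLW : 0 ≤ Real.pi * Real.sqrt 2 / (B.Dtmin - κ₁) * A₁ / (B.Dtmin - κ₁) +
      A₀ * (1 / (B.Dtmin - κ₁) ^ 2 + Real.pi * Real.sqrt 2 * (2 + κ₂) / (B.Dtmin - κ₁) ^ 3) := by positivity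
  have hBW : 0 ≤ A₀ * (Real.pi * Real.sqrt 2 / (B.Dtmin - κ₁)) := by positivity
  have hδW : 0 ≤ Real.pi * Real.sqrt 2 / (B.Dtmin - κ₁) * δA := by positivity
  exact klsw_slice_bubble_transfer_norm_le_quasi hlip hbd hin hout hlip' hbd' hLf' hin' hout' hMF hFlip hFbd hLF hW hLW hδW hBW hWlip hWbd hσc hδ0 hσ
    q₀ hβ hn hM

include B hδ1 hδ hκ hκ₁ in
/-- **THE PLANAR FORWARD BUBBLE WITH ANGLE-DEPENDENT, TUBE-LOCAL QUASI-LIPSCHITZ VERTEX DATA**: `klfb_planar_bubble_norm_le_fn_tube` with the per-ray radial datum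
weakened to `A₁(θ)|t − t'| + δ_A(θ)` (integrable angle profiles); the integrand of the planar bound gains `(131072/π)(ℓ+8M_F)·(π√2/d)·δ_A(θ)`. -/
theorem klfb_planar_bubble_norm_le_fn_tube_quasi {A : ℝ × ℝ → ℂ} (hA : Continuous A) (hAsupp : ∀ p : ℝ × ℝ, A p ≠ 0 → |p.1| < π ∧ |p.2| < π)
    {n : ℕ} {μ : ℝ} {A₀ A₁ δA : ℝ → ℝ} (hA0' : ∀ θ, 0 ≤ A₀ θ) (hA1' : ∀ θ, 0 ≤ A₁ θ) (hδA' : ∀ θ, 0 ≤ δA θ)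
    (hA0i : IntegrableOn A₀ (Ioo (-π) π)) (hA1i : IntegrableOn A₁ (Ioo (-π) π)) (hδAi : IntegrableOn δA (Ioo (-π) π))
    (hA0 : ∀ θ t : ℝ, 0 ≤ t → |klfb_band δ μ (t * Real.cos θ, t * Real.sin θ)| < 4 * klScale klE0 n → ‖A (t * Real.cos θ, t * Real.sin θ)‖ ≤ A₀ θ)
    (hA1 : ∀ θ t t' : ℝ, 0 ≤ t → 0 ≤ t' → |klfb_band δ μ (t * Real.cos θ, t * Real.sin θ)| < 4 * klScale klE0 n →
      |klfb_band δ μ (t' * Real.cos θ, t' * Real.sin θ)| < 4 * klScale klE0 n →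
      ‖A (t * Real.cos θ, t * Real.sin θ) - A (t' * Real.cos θ, t' * Real.sin θ)‖ ≤ A₁ θ * |t - t'| + δA θ)
    {κ₂ : ℝ} (hκ₂ : 0 ≤ κ₂)
    (hD2 : ∀ θ s t : ℝ, s ∈ Icc 0 (π / ‖dir θ‖) → t ∈ Icc 0 (π / ‖dir θ‖) →
      |fderiv ℝ δ (s • dir θ) (dir θ) - fderiv ℝ δ (t • dir θ) (dir θ)| ≤ κ₂ * |s - t|)
    {f f' : ℝ → ℂ} {Lf Mf Lf' Mf' ℓ' LF MF ℓ : ℝ}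
    (hlip : ∀ s s', ‖f s - f s'‖ ≤ Lf * |s - s'|) (hbd : ∀ s, ‖f s‖ ≤ Mf)
    (hin : ∀ s, s ≤ (klScale klE0 n / 2) ^ 2 → f s = 0) (hout : ∀ s, (4 * klScale klE0 n) ^ 2 ≤ s → f s = 0)
    (hlip' : ∀ s s', ‖f' s - f' s'‖ ≤ Lf' * |s - s'|) (hbd' : ∀ s, ‖f' s‖ ≤ Mf') (hLf' : Lf' ≤ ℓ' / klScale klE0 n ^ 2)
    (hin' : ∀ s, s ≤ (klScale klE0 n / 2) ^ 2 → f' s = 0) (hout' : ∀ s, (4 * klScale klE0 n) ^ 2 ≤ s → f' s = 0)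
    (hMF : 0 ≤ MF) (hFlip : ∀ s s', ‖f s * f' s - f s' * f' s'‖ ≤ LF * |s - s'|) (hFbd : ∀ s, ‖f s * f' s‖ ≤ MF)
    (hLF : LF ≤ ℓ / klScale klE0 n ^ 2)
    {e' : ℝ × ℝ → ℝ} (he' : Continuous e') {δmax : ℝ} (hδ0 : 0 ≤ δmax)
    (he'δ : ∀ p : ℝ × ℝ, |p.1| < π → |p.2| < π → |e' p - klfb_band δ μ p| ≤ δmax)
    (hlo : a < μ - 4 * klScale klE0 n - κ₀) (hhi : μ + 4 * klScale klE0 n + κ₀ < b)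
    (q₀ : ℝ) {β : ℝ} (hβ : klBetaMin ≤ β) (hn : n ≤ nScales β + 1) {M : ℕ}
    (hM : β * (4 * klScale klE0 n) / (2 * Real.pi) + 1 ≤ M) :
    ‖β⁻¹ • ∑ i : MatsubaraIdx M, ∫ p : ℝ × ℝ, klfb_integrand δ μ A f f' e' (matsubaraFreq β M i) q₀ p‖ ≤
      ∫ θ in Ioo (-π) π,
        (524288 / Real.pi * (ℓ + 8 * MF) *
            (Real.pi * Real.sqrt 2 / (B.Dtmin - κ₁) * A₁ θ / (B.Dtmin - κ₁) +
              A₀ θ * (1 / (B.Dtmin - κ₁) ^ 2 + Real.pi * Real.sqrt 2 * (2 + κ₂) / (B.Dtmin - κ₁) ^ 3)) * klScale klE0 n +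
          131072 / Real.pi * (ℓ + 8 * MF) * (Real.pi * Real.sqrt 2 / (B.Dtmin - κ₁) * δA θ) +
          393216 / Real.pi * (ℓ + 8 * MF) * (A₀ θ * (Real.pi * Real.sqrt 2 / (B.Dtmin - κ₁))) * ((Real.pi / β) / klScale klE0 n) +
            1024 / Real.pi * Mf * (48 * ℓ' + 193 * Mf') * (A₀ θ * (Real.pi * Real.sqrt 2 / (B.Dtmin - κ₁))) * (|q₀| + δmax) /
              klScale klE0 n) := by
  have hδc : Continuous δ := hδ1.continuous
  have hΛ := klth_klScale_pos n
  have hr₁ : 0 < klScale klE0 n / 2 := by positivity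
  have hr : 0 < 4 * klScale klE0 n := by positivity
  have hcs := klfb_hasCompactSupport_of_square hAsupp
  have hint : ∀ i : MatsubaraIdx M, Integrable (klfb_integrand δ μ A f f' e' (matsubaraFreq β M i) q₀) := by
    intro i
    have hc := klfb_continuous_integrand hδc hA hlip hbd hin hout hr₁ hr hlip' hbd' hin' hout' hr₁ hr he' μ (matsubaraFreq β M i) q₀
    refine hc.integrable_of_hasCompactSupport ?_
    unfold klfb_integrand
    exact (hcs.mul_right).mul_right
  have hBi : IntegrableOn (fun θ =>
      524288 / Real.pi * (ℓ + 8 * MF) *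
            (Real.pi * Real.sqrt 2 / (B.Dtmin - κ₁) * A₁ θ / (B.Dtmin - κ₁) +
              A₀ θ * (1 / (B.Dtmin - κ₁) ^ 2 + Real.pi * Real.sqrt 2 * (2 + κ₂) / (B.Dtmin - κ₁) ^ 3)) * klScale klE0 n +
          131072 / Real.pi * (ℓ + 8 * MF) * (Real.pi * Real.sqrt 2 / (B.Dtmin - κ₁) * δA θ) +
          393216 / Real.pi * (ℓ + 8 * MF) * (A₀ θ * (Real.pi * Real.sqrt 2 / (B.Dtmin - κ₁))) * ((Real.pi / β) / klScale klE0 n) +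
            1024 / Real.pi * Mf * (48 * ℓ' + 193 * Mf') * (A₀ θ * (Real.pi * Real.sqrt 2 / (B.Dtmin - κ₁))) * (|q₀| + δmax) /
              klScale klE0 n) (Ioo (-π) π) := by
    have h1 : IntegrableOn (fun θ => Real.pi * Real.sqrt 2 / (B.Dtmin - κ₁) * A₁ θ / (B.Dtmin - κ₁)) (Ioo (-π) π) :=
      (hA1i.const_mul (Real.pi * Real.sqrt 2 / (B.Dtmin - κ₁))).div_const (B.Dtmin - κ₁)
    have h2 : IntegrableOn (fun θ => A₀ θ * (1 / (B.Dtmin - κ₁) ^ 2 + Real.pi * Real.sqrt 2 * (2 + κ₂) / (B.Dtmin - κ₁) ^ 3))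
        (Ioo (-π) π) := hA0i.mul_const _
    have h3 : IntegrableOn (fun θ => A₀ θ * (Real.pi * Real.sqrt 2 / (B.Dtmin - κ₁))) (Ioo (-π) π) := hA0i.mul_const _
    have h4 : IntegrableOn (fun θ => Real.pi * Real.sqrt 2 / (B.Dtmin - κ₁) * δA θ) (Ioo (-π) π) := hδAi.const_mul _
    exact (((((h1.add h2).const_mul _).mul_const _).add (h4.const_mul _)).add ((h3.const_mul _).mul_const _)).add
      (((h3.const_mul _).mul_const _).div_const _)
  exact klry_norm_smul_sum_integral_le_of_ray_bound_fn hint hBi fun θ _ =>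
    klfb_ray_bubble_norm_le_tube_quasi B hδ1 hδ hκ hκ₁ hA hAsupp θ (hA0' θ) (hA1' θ) (hδA' θ) (hA0 θ) (hA1 θ) hκ₂ (hD2 θ) hlip hbd hin hout
      hlip' hbd' hLf' hin' hout' hMF hFlip hFbd hLF he' hδ0 he'δ hlo hhi q₀ hβ hn hM

end Frame

end Summit.HubbardSuperconductivity.HubbardSuperconductivity.Theorems.KLRegimeSplit

end
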